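import Summits.BirchSwinnertonDyer.Rank1Residual.Additive.TameBranchKatoDivisibilityRankOne
import Summits.BirchSwinnertonDyer.Rank1Residual.AdditivePotMult.PotMultDelbourgo2002Bridge
import Summits.BirchSwinnertonDyer.Rank1Residual.Additive.GordThreeDelbourgo2002Bridge
import Literature.NumberTheory.EllipticCurves.Delbourgo2002.RationalDivisibility
import HarnessLib

/-!
# The typed Kato half `TameBranchRatDvdAt` DISCHARGED from the named fact Delbourgo 2002 Theorem (C)
# (`Delbourgo2002.thmC_charIdeal_dvd_tameBranch`) on the whole potentially-ordinary locus at `p ≥ 5`,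
# and the headline consequences from PRINTED inputs + ONE certified tame branch
# (sub-cell additive-p2, gen 20; cell `b2b-bsdres`)

HONEST FRAMING (cell `b2b-bsdres`, run/shared/lean/b2b/bsd-rank1-residual/, verbatim in every
file): the goal of the cell is to DELETE the COMBINATION-SHAPED residual classes of the
Birch–Swinnerton-Dyer formula for ALL analytic-rank `≤ 1` elliptic curves over `ℚ` — "full BSD
formula for every rank `≤ 1` curve in class `C`" assembled STRICTLY from published theorems — so
that the rank-`≤ 1` remainder becomes exactly the CONSTRUCTION-SHAPED classes, which are TYPED
(missing-input `Prop`s), NOT attempted. This is not "finishing BSD". Research route on the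
CONSTRUCTION-SHAPED classes X3♯(G-ord) / X4♯(G-ord): labels UNCHANGED, NOTHING booked; no definition,
no new named fact here (the fact is `Literature/…/Delbourgo2002/RationalDivisibility.lean`); theorems
only; every published input is an explicit named-fact binder (referee-1 rule R1): `hC` = Delbourgo 2002
(C), `hDel` = Delbourgo 2002 (A)+(B) on (G-ord) (A175), `hDelM` = the same on (M) (n1011-p16), `hGZK`.

## What

`TameBranchKatoDivisibility.lean` typed Delbourgo 2002 Theorem (C) in the cell's tame-branch currency as
`TameBranchRatDvdAt W p` because the interpolation predicate `IsTameBranchOf` is Summits vocabulary.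
The Literature transcription `Delbourgo2002.thmC_charIdeal_dvd_tameBranch` inlines that package
verbatim (`IsTameBranchOf f p ε a B` ↔ its three clauses is `Iff.rfl`; `tameDefect` ↔ the inlined
`if`), so on the locus of the fact — `p ≥ 5`, non-CM, additive, (G)-ordinary OR potentially
multiplicative — the typed input is a THEOREM:
* §1 `tameBranchRatDvdAt_of_thmC` — `thmC` + (A) (`mainTheorem` / `mainTheorem_potMult`, for the
  torsion conjunct) ⟹ `TameBranchRatDvdAt W p` (the multiplicative-twist binder of the (M) disjunct is
  DISCHARGED by n1011-p16's `AdditivePotMult.PotMult.exists_quadraticTwist_mult`).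
* §2 headlines with the typed input discharged: `ClassX4Gord.schneider_rankOne_of_thmC_of_cert` /
  `ClassX3Gord.…` (EVERY defect, `p ≥ 5`, non-CM, `r_an = 1`: Delbourgo (A)+(B)+(C) + GZK + ONE
  integral tame branch with `‖[T¹]B‖_p = 1` ⟹ `Reg_p(E,Dh) ≠ 0` for every (B)-datum — NO image
  hypothesis, NO Kolyvagin beyond GZK, NO main conjecture), `ClassX4Gord/ClassX3Gord.charLamLeAt_of_thmC_of_cert`
  (n1011-p01's λ-certificate from PRINTED inputs + the certificate), and the census join
  `exists_schneider_rankOne_of_thmC_of_ordinaryTwistPartnerAt` (X4-3 locus: `OrdinaryTwistPartnerAt` +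
  `PlusSymbolsPIntegralAt` + the rank-one first-unit-index certificate).

* §3 (`p = 3`, appended): `tameBranchRatDvdAt_three_of_thmC` (Theorem (C) at `p = 3`,
  `Delbourgo2002.thmC_three_charIdeal_dvd_tameBranch`, + `mainTheorem_three` / `mainTheorem_potMult` (A)) and
  `ClassX4Gord/ClassX3Gord.schneider_rankOne_three_of_thmC_of_cert`.

What is NOT claimed: `μ`, any UPPER half, the branch's existence off the census locus, any booking.

References: [Delbourgo2002] Thm. (A)–(C) (p. 40), §3 pp. 58–60; [Washington1997] §7.1;
`Additive/TameBranchKatoDivisibility{,RankOne}.lean` (this seat), `Additive/GordCycRankOneLambda.lean`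
(n1011-p01), `AdditivePotMult/PotMultDelbourgo2002Bridge.lean` (n1011-p16), `Additive/TameBranch*.lean`
(cc-typer-2), `Additive/CensusX43ValueModule.lean` (census-ctyper1).
-/

noncomputable section

open scoped Classical MatrixGroups ModularForm NumberField

open CongruenceSubgroup WeierstrassCurve NumberField Literature.NumberTheory.EllipticCurves
  Literature.NumberTheory.EllipticCurves.ModularForms
  Literature.NumberTheory.EllipticCurves.Rank1Residual
  Literature.NumberTheory.EllipticCurves.Rank1Residual.Typed
  Literature.NumberTheory.EllipticCurves.Delbourgo2002
  IsDedekindDomain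

namespace Summit.BirchSwinnertonDyer.Rank1Residual.Additive

variable {W : WeierstrassCurve ℚ} [W.IsElliptic] [W.IsGloballyMinimal] {p : ℕ} [hp : Fact p.Prime]

/-! ### §1 The typed Kato half is a THEOREM of the named fact (C) + (A) -/

omit hp in
/-- The order binder: `tameDefect W p` is the `if` of the Literature statement. [folklore] -/
theorem tameDefect_eq_ite [Fact p.Prime] :
    tameDefect W p = (if padicValRat p W.j < 0 then 2
      else 12 / Nat.gcd 12 (padicValInt p W.minimalDiscriminantInt)) := by
  by_cases hM : PotMult W p
  · rw [tameDefect_of_potMult W p hM, if_pos (show padicValRat p W.j < 0 from hM)]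
  · rw [tameDefect_of_not_potMult W p hM, if_neg (show ¬ padicValRat p W.j < 0 from hM)]
    rfl

/-- **`TameBranchRatDvdAt W p` from Delbourgo 2002 (A)+(C)** on the fact's locus: `p ≥ 5`, `E = W`
non-CM. For every tame-branch tuple the typed input's conclusion is: torsion — Theorem (A) via
`Delbourgo2002.mainTheorem` on (G-ord) rows / `mainTheorem_potMult` on (M) rows (twist binder by
`AdditivePotMult.PotMult.exists_quadraticTwist_mult`) — and the rational divisibility — Theorem (C),
`Delbourgo2002.thmC_charIdeal_dvd_tameBranch`, whose inlined interpolation package IS `IsTameBranchOf`.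
[cite: Delbourgo2002, Theorem (A), (C) (p. 40)] -/
theorem tameBranchRatDvdAt_of_thmC (hC : Delbourgo2002.thmC_charIdeal_dvd_tameBranch)
    (hDel : Delbourgo2002.mainTheorem) (hDelM : Delbourgo2002.mainTheorem_potMult) (hp5 : 5 ≤ p)
    (hcm : ¬ W.HasCM) : TameBranchRatDvdAt W p := by
  intro κ γ N _ f ε α B hp2 hadd hloc hκ hγ hcv hf hε hα hB D
  have hε' : orderOf ε = (if padicValRat p W.j < 0 then 2
      else 12 / Nat.gcd 12 (padicValInt p W.minimalDiscriminantInt)) := by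
    rw [hε, tameDefect_eq_ite]
  refine ⟨?_, ?_⟩
  · rcases hloc with hM | hG
    · exact AdditivePotMult.PotMult.isTorsion_of_delbourgo2002 hDelM ⟨hadd, hM⟩ hp2 hκ hγ D
    · exact Delbourgo2002.mainTheorem.isTorsion hDel hp5 hcm hadd hG hκ hγ D
  · have hloc' : (∃ (L : Type) (_ : Field L) (_ : NumberField L) (_ : IsCyclotomicExtension {p} ℚ L)
        (F : IntermediateField ℚ L),
        ∀ w : HeightOneSpectrum (𝓞 F), (p : 𝓞 F) ∈ w.asIdeal →
          (W.baseChange F).HasGoodReductionAt w ∧ (W.baseChange F).HasUnitRootAt w) ∨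
      (padicValRat p W.j < 0 ∧
        ∃ d : ℚ, d ≠ 0 ∧ (W.quadraticTwist d).HasMultiplicativeReductionAtPrime p) := by
      rcases hloc with hM | hG
      · exact Or.inr ⟨hM, AdditivePotMult.PotMult.exists_quadraticTwist_mult ⟨hadd, hM⟩ hp2⟩
      · exact Or.inl hG
    exact hC W p hp5 hcm hadd hloc' hκ hγ hcv f hf ε α B hε' hα hB.1 hB.2.1 hB.2.2 D

/-! ### §2 Headlines from PRINTED inputs + ONE certified tame branch -/

/-- **X4♯(G-ord), EVERY defect, `p ≥ 5`, non-CM: the λ-certificate `CharLamLeAt W p n` from Delbourgo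
2002 (A)+(C) and ONE integral tame branch with a unit coefficient at index `n`** — n1011-p01's typed
input is a THEOREM of printed facts modulo the per-pair certificate. [cite: Delbourgo2002, Theorem (A), (C) (p. 40)] -/
theorem ClassX4Gord.charLamLeAt_of_thmC_of_cert (hC : Delbourgo2002.thmC_charIdeal_dvd_tameBranch)
    (hDel : Delbourgo2002.mainTheorem) (hDelM : Delbourgo2002.mainTheorem_potMult)
    (hX : ClassX4Gord W p) (hp5 : 5 ≤ p) (hcm : ¬ W.HasCM)
    {N : ℕ} [NeZero N] {f : CuspForm (Gamma0 N) 2} {ε : DirichletCharacter ℂ_[p] p} {α : ℚ_[p]}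
    {B : PowerSeries ℚ_[p]}
    (hf : IsNewformOf W f) (hε : orderOf ε = tameDefect W p) (hα : ‖α‖ = 1)
    (hB : IsTameBranchOf f p ε α B) (hint : ∀ j : ℕ, ‖PowerSeries.coeff j B‖ ≤ 1)
    {n : ℕ} (hn : ‖PowerSeries.coeff n B‖ = 1) : CharLamLeAt W p n :=
  charLamLeAt_of_tameBranchRatDvdAt_of_integral_of_norm_coeff_eq_one
    (tameBranchRatDvdAt_of_thmC hC hDel hDelM hp5 hcm) (by omega) hX.1.2.1 (Or.inr hX.2) hf hε hα hB
    hint hn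

/-- **X3♯(G-ord) twin** (reducible `E[p]`; every defect, `p ≥ 5`, non-CM): `CharLamLeAt W p n` from
Delbourgo 2002 (A)+(C) and ONE certified tame branch. [cite: Delbourgo2002, Theorem (A), (C) (p. 40)] -/
theorem ClassX3Gord.charLamLeAt_of_thmC_of_cert (hC : Delbourgo2002.thmC_charIdeal_dvd_tameBranch)
    (hDel : Delbourgo2002.mainTheorem) (hDelM : Delbourgo2002.mainTheorem_potMult)
    (hX : ClassX3Gord W p) (hp5 : 5 ≤ p) (hcm : ¬ W.HasCM)
    {N : ℕ} [NeZero N] {f : CuspForm (Gamma0 N) 2} {ε : DirichletCharacter ℂ_[p] p} {α : ℚ_[p]}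
    {B : PowerSeries ℚ_[p]}
    (hf : IsNewformOf W f) (hε : orderOf ε = tameDefect W p) (hα : ‖α‖ = 1)
    (hB : IsTameBranchOf f p ε α B) (hint : ∀ j : ℕ, ‖PowerSeries.coeff j B‖ ≤ 1)
    {n : ℕ} (hn : ‖PowerSeries.coeff n B‖ = 1) : CharLamLeAt W p n :=
  charLamLeAt_of_tameBranchRatDvdAt_of_integral_of_norm_coeff_eq_one
    (tameBranchRatDvdAt_of_thmC hC hDel hDelM hp5 hcm) (by omega) hX.1.2 (Or.inr hX.2) hf hε hα hB
    hint hn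

/-- **X4♯(G-ord), EVERY defect, `p ≥ 5`, non-CM, `ord_{s=1} L(E,s) = 1`: Schneider's `Reg_p(E,Dh) ≠ 0`
for every height datum with Delbourgo's (B)-clauses, from Delbourgo 2002 (A)+(B)+(C), Gross–Zagier–
Kolyvagin (`rank = 1`) and ONE integral tame branch with `‖[T¹]B‖_p = 1`.** All inputs PRINTED except
the per-pair certificate and the tuple; NO image hypothesis, NO main conjecture.
[cite: Delbourgo2002, Theorem (A), (B), (C) (p. 40)] -/
theorem ClassX4Gord.schneider_rankOne_of_thmC_of_cert (hC : Delbourgo2002.thmC_charIdeal_dvd_tameBranch)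
    (hDel : Delbourgo2002.mainTheorem) (hDelM : Delbourgo2002.mainTheorem_potMult)
    (hGZK : rank_eq_analyticRank_of_analyticRank_le_one)
    (hX : ClassX4Gord W p) (hp5 : 5 ≤ p) (hcm : ¬ W.HasCM) (hr : W.analyticRank = 1)
    {N : ℕ} [NeZero N] {f : CuspForm (Gamma0 N) 2} {ε : DirichletCharacter ℂ_[p] p} {α : ℚ_[p]}
    {B : PowerSeries ℚ_[p]}
    (hf : IsNewformOf W f) (hε : orderOf ε = tameDefect W p) (hα : ‖α‖ = 1)
    (hB : IsTameBranchOf f p ε α B) (hint : ∀ j : ℕ, ‖PowerSeries.coeff j B‖ ≤ 1)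
    (h1 : ‖PowerSeries.coeff 1 B‖ = 1)
    {Dh : PAdicHeightData W p} (hBcl : LeadingTermClauses W p Dh) : SchneiderConjecture Dh :=
  hX.schneider_rankOne_of_tameBranchRatDvdAt_of_cert hDel hGZK
    (tameBranchRatDvdAt_of_thmC hC hDel hDelM hp5 hcm) hp5 hcm hr hf hε hα hB hint h1 hBcl

/-- **X3♯(G-ord) twin** (reducible `E[p]`; every defect, `p ≥ 5`, non-CM, `r_an = 1`): Schneider for
every (B)-datum from Delbourgo 2002 (A)+(B)+(C) + GZK + ONE certified tame branch — on X3♯(G-ord) off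
defect 2 the first route to Schneider in the tree, now from PRINTED inputs.
[cite: Delbourgo2002, Theorem (A), (B), (C) (p. 40)] -/
theorem ClassX3Gord.schneider_rankOne_of_thmC_of_cert (hC : Delbourgo2002.thmC_charIdeal_dvd_tameBranch)
    (hDel : Delbourgo2002.mainTheorem) (hDelM : Delbourgo2002.mainTheorem_potMult)
    (hGZK : rank_eq_analyticRank_of_analyticRank_le_one)
    (hX : ClassX3Gord W p) (hp5 : 5 ≤ p) (hcm : ¬ W.HasCM) (hr : W.analyticRank = 1)
    {N : ℕ} [NeZero N] {f : CuspForm (Gamma0 N) 2} {ε : DirichletCharacter ℂ_[p] p} {α : ℚ_[p]}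
    {B : PowerSeries ℚ_[p]}
    (hf : IsNewformOf W f) (hε : orderOf ε = tameDefect W p) (hα : ‖α‖ = 1)
    (hB : IsTameBranchOf f p ε α B) (hint : ∀ j : ℕ, ‖PowerSeries.coeff j B‖ ≤ 1)
    (h1 : ‖PowerSeries.coeff 1 B‖ = 1)
    {Dh : PAdicHeightData W p} (hBcl : LeadingTermClauses W p Dh) : SchneiderConjecture Dh :=
  hX.schneider_rankOne_of_tameBranchRatDvdAt_of_cert hDel hGZK
    (tameBranchRatDvdAt_of_thmC hC hDel hDelM hp5 hcm) hp5 hcm hr hf hε hα hB hint h1 hBcl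

/-- **X4-3 locus (defect `3,4,6`), `ord_{s=1} L(E,s) = 1`, non-CM: Schneider for every (B)-datum and
for Delbourgo's own, from Delbourgo 2002 (A)+(B)+(C) + GZK + the census input
`CensusX43.OrdinaryTwistPartnerAt W p` + `PlusSymbolsPIntegralAt W p` + the rank-one first-unit-index
certificate** — the typeG twin of gen 19's defect-2 headline, all class-level inputs PRINTED.
[cite: Delbourgo2002, Theorem (A), (B), (C) (p. 40)] -/
theorem exists_schneider_rankOne_of_thmC_of_ordinaryTwistPartnerAt
    (hC : Delbourgo2002.thmC_charIdeal_dvd_tameBranch) (hDel : Delbourgo2002.mainTheorem)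
    (hDelM : Delbourgo2002.mainTheorem_potMult) (hGZK : rank_eq_analyticRank_of_analyticRank_le_one)
    (h : CensusX43.OrdinaryTwistPartnerAt W p) (hPI : PlusSymbolsPIntegralAt W p) (h5 : 5 ≤ p)
    (hcm : ¬ W.HasCM) (hadd : Addv W p) (hG : SubGord W p)
    (he : semistabilityIndex W p ∈ ({3, 4, 6} : Finset ℕ)) (hr : W.analyticRank = 1)
    {N : ℕ} [NeZero N] {f : CuspForm (Gamma0 N) 2} (hf : IsNewformOf W f)
    {χ : MulChar (ZMod p) ℚ_[p]}
    (hχ : CensusX43.IsTeichmullerPow χ (CensusX43.ordinaryTeichmullerExponent W p))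
    (hcert : ∀ (ã : ℚ_[p]) (B : PowerSeries ℚ_[p]), ‖ã‖ = 1 →
      IsTameBranchOf f p (χ.ringHomComp (algebraMap ℚ_[p] ℂ_[p])) ã B →
        ‖PowerSeries.coeff 1 B‖ = 1) :
    (∀ Dh : PAdicHeightData W p, LeadingTermClauses W p Dh → SchneiderConjecture Dh) ∧
      ∃ Dh : PAdicHeightData W p, LeadingTermClauses W p Dh ∧ SchneiderConjecture Dh :=
  exists_schneider_rankOne_of_tameBranchRatDvdAt_of_ordinaryTwistPartnerAt hDel hGZK
    (tameBranchRatDvdAt_of_thmC hC hDel hDelM h5 hcm) h hPI h5 hcm hadd hG he hr hf hχ hcert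

/-! ### §3 `p = 3` (appended the same session): the typed Kato half at `3` from Theorem (C) at `p = 3` -/

/-- **`TameBranchRatDvdAt W 3` from Delbourgo 2002 (A)+(C) at `p = 3`** (Hypothesis, second bullet),
`E = W` non-CM: torsion from `mainTheorem_three` on (G-ord)@3 rows (the quadratic-semistability binder
DISCHARGED by `TypeGOrd.exists_goodOrd_twist_model_three`, n1011-p16/p18's bridge over this seat's
gen-7 dictionary) / `mainTheorem_potMult` on (M)@3 rows; the rational divisibility from
`Delbourgo2002.thmC_three_charIdeal_dvd_tameBranch` (its inlined package IS `IsTameBranchOf`).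
[cite: Delbourgo2002, Theorem (A), (C) (p. 40), Hypothesis second bullet (p. 39)] -/
theorem tameBranchRatDvdAt_three_of_thmC [Fact (Nat.Prime 3)] {W : WeierstrassCurve ℚ} [W.IsElliptic]
    [W.IsGloballyMinimal] (hC3 : Delbourgo2002.thmC_three_charIdeal_dvd_tameBranch)
    (hDel3 : Delbourgo2002.mainTheorem_three) (hDelM : Delbourgo2002.mainTheorem_potMult)
    (hcm : ¬ W.HasCM) : TameBranchRatDvdAt W 3 := by
  intro κ γ N _ f ε α B hp2 hadd hloc hκ hγ hcv hf hε hα hB D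
  have hε' : orderOf ε = (if padicValRat 3 W.j < 0 then 2
      else 12 / Nat.gcd 12 (padicValInt 3 W.minimalDiscriminantInt)) := by
    rw [hε, tameDefect_eq_ite]
  refine ⟨?_, ?_⟩
  · rcases hloc with hM | hG
    · exact AdditivePotMult.PotMult.isTorsion_of_delbourgo2002 hDelM ⟨hadd, hM⟩ hp2 hκ hγ D
    · exact TypeGOrd.isTorsion_three_of_delbourgo2002 hDel3 hG hadd hcm hκ hγ D
  · have hloc' : ((∃ (L : Type) (_ : Field L) (_ : NumberField L) (_ : IsCyclotomicExtension {3} ℚ L)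
          (F : IntermediateField ℚ L),
          ∀ w : HeightOneSpectrum (𝓞 F), ((3 : ℕ) : 𝓞 F) ∈ w.asIdeal →
            (W.baseChange F).HasGoodReductionAt w ∧ (W.baseChange F).HasUnitRootAt w) ∧
        ∃ (d : ℚ) (V : WeierstrassCurve ℚ) (_ : V.IsElliptic) (_ : V.IsGloballyMinimal)
          (C : VariableChange ℚ), d ≠ 0 ∧ C • W.quadraticTwist d = V ∧
          V.HasGoodReductionAtPrime 3 ∧ ¬ ((3 : ℕ) : ℤ) ∣ V.frobeniusTrace 3) ∨
      (padicValRat 3 W.j < 0 ∧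
        ∃ d : ℚ, d ≠ 0 ∧ (W.quadraticTwist d).HasMultiplicativeReductionAtPrime 3) := by
      rcases hloc with hM | hG
      · exact Or.inr ⟨hM, AdditivePotMult.PotMult.exists_quadraticTwist_mult ⟨hadd, hM⟩ hp2⟩
      · exact Or.inl ⟨hG, hG.exists_goodOrd_twist_model_three hadd⟩
    exact hC3 W 3 rfl hcm hadd hloc' hκ hγ hcv f hf ε α B hε' hα hB.1 hB.2.1 hB.2.2 D

/-- **X4♯(G-ord) at `p = 3` (Kodaira `I₀*`), non-CM, `ord_{s=1} L(E,s) = 1`: Schneider's `Reg₃(E,Dh) ≠ 0`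
for every height datum with Delbourgo's (B)-clauses at `3`, from Delbourgo 2002 (A)+(B)+(C) at `p = 3`
(`mainTheorem_three`, `thmC_three…`), GZK and ONE integral tame branch with `‖[T¹]B‖₃ = 1`.** NO image
hypothesis. [cite: Delbourgo2002, Theorem (A), (B), (C) (p. 40), Hypothesis (p. 39)] -/
theorem ClassX4Gord.schneider_rankOne_three_of_thmC_of_cert [Fact (Nat.Prime 3)]
    {W : WeierstrassCurve ℚ} [W.IsElliptic] [W.IsGloballyMinimal]
    (hC3 : Delbourgo2002.thmC_three_charIdeal_dvd_tameBranch)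
    (hDel3 : Delbourgo2002.mainTheorem_three) (hDelM : Delbourgo2002.mainTheorem_potMult)
    (hGZK : rank_eq_analyticRank_of_analyticRank_le_one)
    (hX : ClassX4Gord W 3) (hcm : ¬ W.HasCM) (hr : W.analyticRank = 1)
    {N : ℕ} [NeZero N] {f : CuspForm (Gamma0 N) 2} {ε : DirichletCharacter ℂ_[3] 3} {α : ℚ_[3]}
    {B : PowerSeries ℚ_[3]}
    (hf : IsNewformOf W f) (hε : orderOf ε = tameDefect W 3) (hα : ‖α‖ = 1)
    (hB : IsTameBranchOf f 3 ε α B) (hint : ∀ j : ℕ, ‖PowerSeries.coeff j B‖ ≤ 1)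
    (h1 : ‖PowerSeries.coeff 1 B‖ = 1)
    {Dh : PAdicHeightData W 3} (hBcl : LeadingTermClauses W 3 Dh) : SchneiderConjecture Dh := by
  obtain ⟨hmw, -⟩ := hGZK W (by rw [hr])
  have hr1 : W.mordellWeilRank = 1 := by rw [hmw, hr]
  exact (schneider_and_finite_of_tameBranchRatDvdAt_of_cert (tameBranchRatDvdAt_three_of_thmC hC3 hDel3
    hDelM hcm) (by decide) hX.1.2.1 (Or.inr hX.2) hf hε hα hB hint ⟨1, by rw [hr1], h1⟩ hBcl
    (fun _ _ hκ hγ D ↦ TypeGOrd.isTorsion_three_of_delbourgo2002 hDel3 hX.2 hX.1.2.1 hcm hκ hγ D)).1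

/-- **X3♯(G-ord) at `p = 3`** (reducible `E[3]`, Kodaira `I₀*`), non-CM, `r_an = 1`: Schneider for every
(B)-datum at `3` from Delbourgo 2002 (A)+(B)+(C) at `p = 3` + GZK + ONE certified tame branch.
[cite: Delbourgo2002, Theorem (A), (B), (C) (p. 40), Hypothesis (p. 39)] -/
theorem ClassX3Gord.schneider_rankOne_three_of_thmC_of_cert [Fact (Nat.Prime 3)]
    {W : WeierstrassCurve ℚ} [W.IsElliptic] [W.IsGloballyMinimal]
    (hC3 : Delbourgo2002.thmC_three_charIdeal_dvd_tameBranch)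
    (hDel3 : Delbourgo2002.mainTheorem_three) (hDelM : Delbourgo2002.mainTheorem_potMult)
    (hGZK : rank_eq_analyticRank_of_analyticRank_le_one)
    (hX : ClassX3Gord W 3) (hcm : ¬ W.HasCM) (hr : W.analyticRank = 1)
    {N : ℕ} [NeZero N] {f : CuspForm (Gamma0 N) 2} {ε : DirichletCharacter ℂ_[3] 3} {α : ℚ_[3]}
    {B : PowerSeries ℚ_[3]}
    (hf : IsNewformOf W f) (hε : orderOf ε = tameDefect W 3) (hα : ‖α‖ = 1)
    (hB : IsTameBranchOf f 3 ε α B) (hint : ∀ j : ℕ, ‖PowerSeries.coeff j B‖ ≤ 1)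
    (h1 : ‖PowerSeries.coeff 1 B‖ = 1)
    {Dh : PAdicHeightData W 3} (hBcl : LeadingTermClauses W 3 Dh) : SchneiderConjecture Dh := by
  obtain ⟨hmw, -⟩ := hGZK W (by rw [hr])
  have hr1 : W.mordellWeilRank = 1 := by rw [hmw, hr]
  exact (schneider_and_finite_of_tameBranchRatDvdAt_of_cert (tameBranchRatDvdAt_three_of_thmC hC3 hDel3
    hDelM hcm) (by decide) hX.1.2 (Or.inr hX.2) hf hε hα hB hint ⟨1, by rw [hr1], h1⟩ hBcl
    (fun _ _ hκ hγ D ↦ TypeGOrd.isTorsion_three_of_delbourgo2002 hDel3 hX.2 hX.1.2 hcm hκ hγ D)).1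

end Summit.BirchSwinnertonDyer.Rank1Residual.Additive

end
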